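import Literature.MathematicalPhysics.QuantumFieldTheory.Sweep1ChatterjeeFreeEnergyProofs
import Summits.QuantumFields.YangMills.Theorems.EquipartitionCriticalityFreeEnergyLogCoefficientDefs
import HarnessLib

/-!
# The Wilson action in an exponential chart and the Gaussian sandwich — crux
`FreeEnergyLogCoefficient`, line `Sketch`, stub `chartAction`

Chatterjee, *The leading term of the Yang–Mills free energy* (arXiv:1602.01222), Theorem 16.3 and
Lemmas 17.2/17.6 up to the Gaussian integral, for a compact group `G` with a continuous unitary
matrix representation `ρ` and an abstract chart `ψ : ℝ^D → G` with `ρ ∘ ψ = exp ∘ ι₀` (`ι₀` a linear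
isometry into `𝔲(N)`); all chart and measure facts are hypotheses. Port of
`WilsonWeakCoupling.{abs_plaquetteCost_chart_sub_le, abs_S_chart_sub_maxwell_le, weight_chartPi_le,
le_weight_chartPi, Z_le_gaussian, gaussian_le_Z}` (file `WilsonWeakCouplingBounds`, Cayley chart).
-/

noncomputable section

open scoped Matrix Matrix.Norms.Frobenius ENNReal NNReal
open MeasureTheory Measure Filter Topology Set
open Literature.Probability.LatticeModels Literature.MathematicalPhysics.QuantumLattice
open Literature.MathematicalPhysics.QuantumFieldTheory

namespace Summit.QuantumFields.YangMills.Theorems.FreeEnergyLogCoefficient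
namespace ChartAction

open AxialGauge WilsonWeakCoupling

variable {d N : ℕ} {G : Type*} [Group G]

/-! ### The configuration `ψ ∘ H` in the chart -/

section Algebra

variable {D : ℕ} {n : ℕ}

/-- The norm of `zeroExtV a` is bounded by that of `a`. [folklore] -/
theorem norm_zeroExtV_le {V : Type*} [NormedAddCommGroup V] {a : FreeIdx d n → V} {η : ℝ}
    (hη : 0 ≤ η) (ha : ∀ e, ‖a e‖ ≤ η)
    (e : Literature.MathematicalPhysics.QuantumFieldTheory.ZdEdge d) : ‖zeroExtV a e‖ ≤ η := by
  unfold zeroExtV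
  split_ifs
  · simpa using hη
  · exact ha _
  · simpa using hη

/-- `N - Re tr M = Re tr (1 - M)`. [folklore] -/
theorem sub_re_trace_eq_re_trace_one_sub (M : Matrix (Fin N) (Fin N) ℂ) :
    (N : ℝ) - M.trace.re = ((1 - M).trace).re := by
  rw [Matrix.trace_sub, Complex.sub_re, Matrix.trace_one, Fintype.card_fin]
  simp

variable (ρ : G →* Matrix (Fin N) (Fin N) ℂ)

/-- A matrix representation of a group sends inverses to (nonsingular) inverses. [folklore] -/
theorem map_inv_eq_inv (g : G) : ρ g⁻¹ = (ρ g)⁻¹ :=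
  (Matrix.inv_eq_left_inv (by rw [← map_mul, inv_mul_cancel, map_one])).symm

variable {ρ} (ι₀ : EuclideanSpace ℝ (Fin D) →ₗᵢ[ℝ] Matrix (Fin N) (Fin N) ℂ)
  {ψ : EuclideanSpace ℝ (Fin D) → G} (hψ : ∀ a, ρ (ψ a) = NormedSpace.exp (ι₀ a))
include hψ

/-- In the chart, `ρ` of the gauge-fixed configuration `(1, ψ ∘ a)` is `exp ∘ ι₀ ∘ zeroExtV a` on
every edge of the box. [folklore] -/
theorem rho_ext_ext₁_apply (a : FreeIdx d n → EuclideanSpace ℝ (Fin D))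
    {e : Literature.MathematicalPhysics.QuantumFieldTheory.ZdEdge d} (he : e ∈ boxEdges d n) :
    ρ (ext (ext₁ fun i => ψ (a i)) e) = NormedSpace.exp (ι₀ (zeroExtV a e)) := by
  rw [ext_apply_of_mem _ he]
  by_cases hc : IsComb e
  · rw [ext₁_apply_of_isComb _ hc]
    simp [zeroExtV, he, hc]
  · rw [ext₁_apply_of_not_isComb _ hc]
    simp [zeroExtV, he, hc, hψ]

/-- `ρ` of a plaquette holonomy of `(1, ψ ∘ a)` is the four-product
`e^{Y₁} e^{Y₂} e^{-Y₃} e^{-Y₄}` of exponentials of the chart parameters. [cite: arXiv160201222, §16] -/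
theorem rho_plaquette_eq (a : FreeIdx d n → EuclideanSpace ℝ (Fin D)) {p : Plaq d}
    (hp : p ∈ plaquettesIn (halfOpenBox d n)) :
    ρ ((ext (ext₁ fun i => ψ (a i))).plaquette p.1 p.2.1 p.2.2) =
      NormedSpace.exp (ι₀ (zeroExtV a (p.1, p.2.1))) *
        NormedSpace.exp (ι₀ (zeroExtV a (p.1 + Pi.single p.2.1 1, p.2.2))) *
        NormedSpace.exp (-ι₀ (zeroExtV a (p.1 + Pi.single p.2.2 1, p.2.1))) *
        NormedSpace.exp (-ι₀ (zeroExtV a (p.1, p.2.2))) := by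
  obtain ⟨h1, h2, h3, h4⟩ := edges_mem_boxEdges hp
  rw [ZdGaugeConfig.plaquette, map_mul, map_mul, map_mul, map_inv_eq_inv, map_inv_eq_inv,
    rho_ext_ext₁_apply ι₀ hψ a h1, rho_ext_ext₁_apply ι₀ hψ a h2, rho_ext_ext₁_apply ι₀ hψ a h3,
    rho_ext_ext₁_apply ι₀ hψ a h4, ← Matrix.exp_neg, ← Matrix.exp_neg]

variable (hι₀ : ∀ a, (ι₀ a)ᴴ = -(ι₀ a)) {A₀ : ℝ}
    (h4 : ∀ (Y₁ Y₂ Y₃ Y₄ : Matrix (Fin N) (Fin N) ℂ),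
      Y₁ᴴ = -Y₁ → Y₂ᴴ = -Y₂ → Y₃ᴴ = -Y₃ → Y₄ᴴ = -Y₄ → ∀ η : ℝ, η ≤ 1 →
      ‖Y₁‖ ≤ η → ‖Y₂‖ ≤ η → ‖Y₃‖ ≤ η → ‖Y₄‖ ≤ η →
      |((1 - NormedSpace.exp Y₁ * NormedSpace.exp Y₂ * NormedSpace.exp Y₃ *
          NormedSpace.exp Y₄).trace).re - ‖Y₁ + Y₂ + Y₃ + Y₄‖ ^ 2 / 2| ≤ A₀ * N * η ^ 3)
include hι₀ h4

/-- **Lemma 16.2 on a plaquette of the box, in the chart `ψ`**: if the four-product bound holds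
with constant `A₀` and all chart parameters have norm `≤ η ≤ 1`, the plaquette cost of `ψ ∘ H` is
`½ ‖H(p)‖² + O(A₀ N η³)`. [cite: arXiv160201222, Lemma 16.2] -/
theorem abs_plaquetteCost_sub_le {a : FreeIdx d n → EuclideanSpace ℝ (Fin D)} {η : ℝ} (hη0 : 0 ≤ η)
    (hη1 : η ≤ 1) (ha : ∀ e, ‖a e‖ ≤ η) {p : Plaq d} (hp : p ∈ plaquettesIn (halfOpenBox d n)) :
    |((N : ℝ) - (ρ ((ext (ext₁ fun i => ψ (a i))).plaquette p.1 p.2.1 p.2.2)).trace.re) -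
      ‖circV (zeroExtV a) p‖ ^ 2 / 2| ≤ A₀ * N * η ^ 3 := by
  set H := zeroExtV a
  rw [sub_re_trace_eq_re_trace_one_sub, rho_plaquette_eq ι₀ hψ a hp]
  have hsk : ∀ z : EuclideanSpace ℝ (Fin D), (-ι₀ z)ᴴ = -(-ι₀ z) := fun z => by
    rw [Matrix.conjTranspose_neg, hι₀]
  have hn : ∀ e, ‖ι₀ (H e)‖ ≤ η := fun e => by
    rw [LinearIsometry.norm_map]; exact norm_zeroExtV_le hη0 ha e
  have hn' : ∀ e, ‖-ι₀ (H e)‖ ≤ η := fun e => by rw [norm_neg]; exact hn e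
  have key := h4 _ _ _ _ (hι₀ (H (p.1, p.2.1))) (hι₀ (H (p.1 + Pi.single p.2.1 1, p.2.2)))
    (hsk (H (p.1 + Pi.single p.2.2 1, p.2.1))) (hsk (H (p.1, p.2.2))) η hη1 (hn _) (hn _) (hn' _)
    (hn' _)
  have hsum : ι₀ (H (p.1, p.2.1)) + ι₀ (H (p.1 + Pi.single p.2.1 1, p.2.2)) +
      -ι₀ (H (p.1 + Pi.single p.2.2 1, p.2.1)) + -ι₀ (H (p.1, p.2.2)) = ι₀ (circV H p) := by
    simp only [circV, map_add, map_sub]; abel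
  rw [hsum, LinearIsometry.norm_map] at key
  exact key

/-- **Theorem 16.3 (from the Wilson action to the Maxwell action) in the chart `ψ`**: if all chart
parameters have norm `≤ η ≤ 1`, then `|S_{B_n}(ψ ∘ H) - ½ M_n(H)| ≤ A₀ N η³ |B_n'|`. [cite: arXiv160201222, Thm. 16.3] -/
theorem abs_action_sub_maxwellV_le {a : FreeIdx d n → EuclideanSpace ℝ (Fin D)} {η : ℝ} (hη0 : 0 ≤ η)
    (hη1 : η ≤ 1) (ha : ∀ e, ‖a e‖ ≤ η) :
    |zdWilsonAction ρ (halfOpenBox d n) (ext (ext₁ fun i => ψ (a i))) - maxwellV d n a / 2| ≤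
      A₀ * N * η ^ 3 * (ChatterjeeAssembly.Pn d n : ℝ) := by
  unfold zdWilsonAction maxwellV ChatterjeeAssembly.Pn
  rw [Finset.sum_div, ← Finset.sum_sub_distrib]
  refine (Finset.abs_sum_le_sum_abs _ _).trans ?_
  calc ∑ p ∈ plaquettesIn (halfOpenBox d n), |((N : ℝ) -
          (ρ ((ext (ext₁ fun i => ψ (a i))).plaquette p.1 p.2.1 p.2.2)).trace.re) -
          ‖circV (zeroExtV a) p‖ ^ 2 / 2|
      ≤ ∑ _p ∈ plaquettesIn (halfOpenBox d n), A₀ * N * η ^ 3 :=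
        Finset.sum_le_sum fun p hp => abs_plaquetteCost_sub_le ι₀ hψ hι₀ h4 hη0 hη1 ha hp
    _ = A₀ * N * η ^ 3 * ((plaquettesIn (halfOpenBox d n)).card : ℝ) := by
        rw [Finset.sum_const, nsmul_eq_mul]; ring

end Algebra

/-! ### From the action comparison to the comparison of weights -/

section Weights

variable {S M A β r P : ℝ}

/-- `|S - M/2| ≤ A r³ P` gives `e^{-βS} ≤ e^{Aβr³P} e^{-βM/2}` for `β ≥ 0`. [folklore] -/
theorem weight_le_of_abs_le (hβ : 0 ≤ β) (h : |S - M / 2| ≤ A * r ^ 3 * P) :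
    ENNReal.ofReal (Real.exp (-β * S)) ≤
      ENNReal.ofReal (Real.exp (A * β * r ^ 3 * P)) * ENNReal.ofReal (Real.exp (-β * M / 2)) := by
  rw [← ENNReal.ofReal_mul (Real.exp_pos _).le, ← Real.exp_add]
  apply ENNReal.ofReal_le_ofReal
  apply Real.exp_le_exp.2
  have hmul := mul_le_mul_of_nonneg_left (abs_le.1 h).1 hβ
  linarith [hmul]

/-- `|S - M/2| ≤ A r³ P` gives `e^{-Aβr³P} e^{-βM/2} ≤ e^{-βS}` for `β ≥ 0`. [folklore] -/
theorem le_weight_of_abs_le (hβ : 0 ≤ β) (h : |S - M / 2| ≤ A * r ^ 3 * P) :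
    ENNReal.ofReal (Real.exp (-(A * β * r ^ 3 * P))) * ENNReal.ofReal (Real.exp (-β * M / 2)) ≤
      ENNReal.ofReal (Real.exp (-β * S)) := by
  rw [← ENNReal.ofReal_mul (Real.exp_pos _).le, ← Real.exp_add]
  apply ENNReal.ofReal_le_ofReal
  apply Real.exp_le_exp.2
  have hmul := mul_le_mul_of_nonneg_left (abs_le.1 h).2 hβ
  linarith [hmul]

/-- Membership in the product ball as a bound on the norms. [folklore] -/
theorem norm_le_of_mem_pi {ι V : Type*} [SeminormedAddCommGroup V] {a : ι → V}
    (ha : a ∈ Set.pi Set.univ fun _ => Metric.closedBall (0 : V) r) (e : ι) : ‖a e‖ ≤ r := by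
  simpa using ha e (Set.mem_univ _)

end Weights

/-! ### Measurability -/

section Measurability

variable {D n : ℕ}

/-- The Maxwell action is continuous in the chart parameters. [folklore] -/
theorem continuous_maxwellV {V : Type*} [NormedAddCommGroup V] :
    Continuous (maxwellV d n : (FreeIdx d n → V) → ℝ) := by
  unfold maxwellV circV zeroExtV
  refine continuous_finsetSum _ fun p _ => ?_
  refine (Continuous.norm ?_).pow 2
  have hc : ∀ e : Literature.MathematicalPhysics.QuantumFieldTheory.ZdEdge d,
      Continuous fun a : FreeIdx d n → V =>
        (if h : e ∈ boxEdges d n then (if hc : IsComb e then (0 : V) else a ⟨⟨e, h⟩, hc⟩) else 0) := by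
    intro e
    split_ifs
    · exact continuous_const
    · exact continuous_apply _
    · exact continuous_const
  exact (((hc (p.1, p.2.1)).add (hc (p.1 + Pi.single p.2.1 1, p.2.2))).sub
    (hc (p.1 + Pi.single p.2.2 1, p.2.1))).sub (hc (p.1, p.2.2))

/-- Measurability of the Maxwell weight `e^{-β M_n(a)/2}`. [folklore] -/
theorem measurable_maxwellWeight (β : ℝ) :
    Measurable fun a : FreeIdx d n → EuclideanSpace ℝ (Fin D) =>
      ENNReal.ofReal (Real.exp (-β * maxwellV d n a / 2)) :=
  ENNReal.measurable_ofReal.comp (Real.measurable_exp.comp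
    ((continuous_maxwellV.measurable.const_mul _).div_const _))

variable [TopologicalSpace G] [IsTopologicalGroup G] (ρ : G →* Matrix (Fin N) (Fin N) ℂ)

/-- The Wilson action of the cube is a continuous function of the box configuration. [folklore] -/
theorem continuous_action_ext (hρ : Continuous ρ) :
    Continuous fun u : BoxCfg d G n => zdWilsonAction ρ (halfOpenBox d n) (ext u) :=
  (AreaLaw.continuous_zdWilsonAction ρ hρ _).comp (continuous_pi fun e => by
    by_cases h : e ∈ boxEdges d n
    · simp only [AxialGauge.ext, dif_pos h]; exact continuous_apply _
    · simp only [AxialGauge.ext, dif_neg h]; exact continuous_const)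

variable [MeasurableSpace G] [BorelSpace G] [SecondCountableTopology G]

/-- The weight `e^{-β S}` of the gauge-fixed configuration `(1, v)` is a measurable function of the
free variables `v`. [folklore] -/
theorem measurable_weight_free (hρ : Continuous ρ) (β : ℝ) :
    Measurable fun v : FreeIdx d n → G =>
      ENNReal.ofReal (Real.exp (-β * zdWilsonAction ρ (halfOpenBox d n) (ext (ext₁ v)))) :=
  ENNReal.measurable_ofReal.comp (Real.measurable_exp.comp
    (((continuous_action_ext ρ hρ).measurable.comp measurable_ext₁).const_mul _))

variable [CompactSpace G]

/-- **Cor. 9.4 for the partition function**: `Z(B_n, β) = ∫_{G^{E_n^1}} e^{-β S(1, v)} dσ^{E_n^1}(v)`. [cite: arXiv160201222, Cor. 9.4] -/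
theorem zdPartitionFunction_eq_lintegral_free (hρ : Continuous ρ) (β : ℝ) :
    zdPartitionFunction ρ β (halfOpenBox d n) =
      ∫⁻ v, ENNReal.ofReal (Real.exp (-β * zdWilsonAction ρ (halfOpenBox d n) (ext (ext₁ v))))
        ∂(Measure.pi fun _ : FreeIdx d n => haarProbability G) := by
  rw [zdPartitionFunction_eq_lintegral_pi ρ hρ β n]
  exact lintegral_pi_eq_lintegral_free (ENNReal.measurable_ofReal.comp (Real.measurable_exp.comp
    ((continuous_action_ext ρ hρ).measurable.const_mul _))) fun u => by
      simp only [zdWilsonAction_ext_gaugeFixBox (ρ := ρ)]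

end Measurability

end ChartAction

/-! ### The stub -/

section Stub

open AxialGauge WilsonWeakCoupling ChartAction

variable {d N : ℕ} {G : Type*} [Group G] [TopologicalSpace G] [IsTopologicalGroup G]
  [CompactSpace G] [MeasurableSpace G] [BorelSpace G]

/-- The Theorem-10.1 radius `ρ₀ = (2dn(Cn^d log β + log 2)/β)^{1/2}` is positive for `d, n ≥ 1`,
`β ≥ 2`, `C > 0`. [cite: arXiv160201222, Thm. 10.1] -/
theorem ChartAction.rho0_pos (hd : 1 ≤ d) {C : ℝ} (hC : 0 < C) {n : ℕ} (hn : 1 ≤ n) {β : ℝ}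
    (hβ : 2 ≤ β) : 0 < rho0 C d n β := by
  unfold rho0
  have hd' : (1 : ℝ) ≤ d := by exact_mod_cast hd
  have hn' : (1 : ℝ) ≤ n := by exact_mod_cast hn
  have hlog : 0 < Real.log β := Real.log_pos (by linarith)
  have hlog2 : 0 < Real.log 2 := Real.log_pos one_lt_two
  apply Real.sqrt_pos.2
  positivity

/-- **STUB 5 — the chart comparison of the Wilson action with the Maxwell action and the Gaussian
sandwich (Chatterjee Thm. 16.3, Lemmas 17.2/17.6 up to the Gaussian integral).** For a chart
`ψ : ℝ^D → G` with `ρ ∘ ψ = exp ∘ ι₀`, `ι₀` an isometry into `𝔲(N)`, the four-product bound with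
constant `A₀`, the Theorem 7.1/10.1 constant `C`, and the two-sided product comparison of Haar and
Lebesgue integrals near `1` (constants `cH`, `κ`, radius `r₁ ≤ 1`, `B(1, r/κ r) ⊆ ψ(b(0,r))`, `κ ≤ 2`):
`Z ≤ 2 cH^{|E_n^1|} e^{A₀Nβ(2ρ₀)³|B_n'|} ∫ e^{−βM_n(a)/2} da` when `ρ₀ ≤ r₁/2`, and
`Z ≥ (cH κ(r)^{−D})^{|E_n^1|} e^{−A₀Nβr³|B_n'|} ∫_{b(0,r)^{E_n^1}} e^{−βM_n(a)/2} da` for `0 < r ≤ r₁`.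
Port of `WilsonWeakCoupling.{abs_plaquetteCost_chart_sub_le, abs_S_chart_sub_maxwell_le,
weight_chartPi_le, le_weight_chartPi, Z_le_gaussian, gaussian_le_Z}` with `maxwellV` on `ℝ^D`. [cite: arXiv160201222, Thm. 16.3, Lemmas 17.2, 17.6] -/
theorem stub_chartAction [SecondCountableTopology G] (hd : 1 ≤ d) (ρ : G →* Matrix (Fin N) (Fin N) ℂ)
    (hρ : Continuous ρ) (hU : ∀ g, ρ g ∈ Matrix.unitaryGroup (Fin N) ℂ) {D : ℕ}
    (ι₀ : EuclideanSpace ℝ (Fin D) →ₗᵢ[ℝ] Matrix (Fin N) (Fin N) ℂ) (hι₀ : ∀ a, (ι₀ a)ᴴ = -(ι₀ a))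
    (ψ : EuclideanSpace ℝ (Fin D) → G) (hψm : Measurable ψ)
    (hψ : ∀ a, ρ (ψ a) = NormedSpace.exp (ι₀ a))
    {A₀ : ℝ} (hA₀ : 0 ≤ A₀)
    (h4 : ∀ (Y₁ Y₂ Y₃ Y₄ : Matrix (Fin N) (Fin N) ℂ),
      Y₁ᴴ = -Y₁ → Y₂ᴴ = -Y₂ → Y₃ᴴ = -Y₃ → Y₄ᴴ = -Y₄ → ∀ η : ℝ, η ≤ 1 →
      ‖Y₁‖ ≤ η → ‖Y₂‖ ≤ η → ‖Y₃‖ ≤ η → ‖Y₄‖ ≤ η →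
      |((1 - NormedSpace.exp Y₁ * NormedSpace.exp Y₂ * NormedSpace.exp Y₃ *
          NormedSpace.exp Y₄).trace).re - ‖Y₁ + Y₂ + Y₃ + Y₄‖ ^ 2 / 2| ≤ A₀ * N * η ^ 3)
    {C : ℝ} (hC : 0 < C)
    (h101 : ∀ (n : ℕ) (β : ℝ), 2 ≤ β → zdPartitionFunction ρ β (halfOpenBox d n) ≤
      2 * ∫⁻ v in Set.pi Set.univ (fun _ => {g : G | ‖ρ g - 1‖ ≤ WilsonWeakCoupling.rho0 C d n β}),
        ENNReal.ofReal (Real.exp (-β * zdWilsonAction ρ (halfOpenBox d n)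
          (AxialGauge.ext (AxialGauge.ext₁ v))))
        ∂(Measure.pi fun _ : WilsonWeakCoupling.FreeIdx d n => haarProbability G))
    {cH r₁ : ℝ} (hcH : 0 < cH) (hr₁ : r₁ ≤ 1) {κ : ℝ → ℝ}
    (hκ : ∀ r : ℝ, 0 ≤ r → r ≤ r₁ → 1 ≤ κ r ∧ κ r ≤ 2)
    (hincl : ∀ r : ℝ, 0 ≤ r → r ≤ r₁ → {g : G | ‖ρ g - 1‖ ≤ r / κ r} ⊆ ψ '' Metric.closedBall 0 r)
    (hup : ∀ (n : ℕ) (r : ℝ), 0 < r → r ≤ r₁ →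
      ∀ F : (WilsonWeakCoupling.FreeIdx d n → G) → ℝ≥0∞, Measurable F →
      ∫⁻ U in Set.pi Set.univ (fun _ => ψ '' Metric.closedBall 0 r), F U
          ∂(Measure.pi fun _ : WilsonWeakCoupling.FreeIdx d n => haarProbability G) ≤
        ENNReal.ofReal cH ^ Fintype.card (WilsonWeakCoupling.FreeIdx d n) *
          ∫⁻ a in Set.pi Set.univ (fun _ => Metric.closedBall (0 : EuclideanSpace ℝ (Fin D)) r),
            F (fun i => ψ (a i)))
    (hlow : ∀ (n : ℕ) (r : ℝ), 0 < r → r ≤ r₁ →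
      ∀ F : (WilsonWeakCoupling.FreeIdx d n → G) → ℝ≥0∞, Measurable F →
      ((ENNReal.ofReal (κ r ^ D))⁻¹ * ENNReal.ofReal cH) ^
            Fintype.card (WilsonWeakCoupling.FreeIdx d n) *
          ∫⁻ a in Set.pi Set.univ (fun _ => Metric.closedBall (0 : EuclideanSpace ℝ (Fin D)) r),
            F (fun i => ψ (a i)) ≤
        ∫⁻ U in Set.pi Set.univ (fun _ => ψ '' Metric.closedBall 0 r), F U
          ∂(Measure.pi fun _ : WilsonWeakCoupling.FreeIdx d n => haarProbability G)) :
    (∀ (n : ℕ) (β : ℝ), 1 ≤ n → 2 ≤ β → WilsonWeakCoupling.rho0 C d n β ≤ r₁ / 2 →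
      zdPartitionFunction ρ β (halfOpenBox d n) ≤
        2 * (ENNReal.ofReal cH ^ Fintype.card (WilsonWeakCoupling.FreeIdx d n) *
          (ENNReal.ofReal (Real.exp (A₀ * N * β * (2 * WilsonWeakCoupling.rho0 C d n β) ^ 3 *
              (ChatterjeeAssembly.Pn d n : ℝ))) *
            ∫⁻ a : WilsonWeakCoupling.FreeIdx d n → EuclideanSpace ℝ (Fin D),
              ENNReal.ofReal (Real.exp (-β * maxwellV d n a / 2))))) ∧
    (∀ (n : ℕ) (β : ℝ), 1 ≤ n → 0 ≤ β → ∀ r : ℝ, 0 < r → r ≤ r₁ →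
      ((ENNReal.ofReal (κ r ^ D))⁻¹ * ENNReal.ofReal cH) ^
            Fintype.card (WilsonWeakCoupling.FreeIdx d n) *
          (ENNReal.ofReal (Real.exp (-(A₀ * N * β * r ^ 3 * (ChatterjeeAssembly.Pn d n : ℝ)))) *
            ∫⁻ a in Set.pi Set.univ
                (fun _ : WilsonWeakCoupling.FreeIdx d n => Metric.closedBall (0 : EuclideanSpace ℝ (Fin D)) r),
              ENNReal.ofReal (Real.exp (-β * maxwellV d n a / 2))) ≤
        zdPartitionFunction ρ β (halfOpenBox d n)) := by
  -- unitarity, `0 ≤ A₀` and `0 < cH` belong to the registered interface but are not needed here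
  have _ := hU; have _ := hA₀; have _ := hcH
  have hψPi : ∀ n : ℕ, Measurable fun (a : FreeIdx d n → EuclideanSpace ℝ (Fin D)) (i : FreeIdx d n) =>
      ψ (a i) := fun n => measurable_pi_lambda _ fun i => hψm.comp (measurable_pi_apply i)
  refine ⟨fun n β hn hβ hρr => ?_, fun n β _ hβ r hr hrr₁ => ?_⟩
  · -- Lemma 17.2 up to the Gaussian integral
    have hβ0 : 0 ≤ β := by linarith
    have hρ0 : 0 < rho0 C d n β := rho0_pos hd hC hn hβ
    set r := 2 * rho0 C d n β
    have hr0 : 0 < r := by positivity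
    have hrr₁ : r ≤ r₁ := by linarith
    have hr1 : r ≤ 1 := hrr₁.trans hr₁
    set f := fun v : FreeIdx d n → G =>
      ENNReal.ofReal (Real.exp (-β * zdWilsonAction ρ (halfOpenBox d n) (ext (ext₁ v))))
    have hfm : Measurable f := measurable_weight_free ρ hρ β
    refine (h101 n β hβ).trans (mul_le_mul_right ?_ 2)
    -- enlarge the domain to the product of chart images (Cor. 11.3 with `κ ≤ 2`)
    have hball : {g : G | ‖ρ g - 1‖ ≤ rho0 C d n β} ⊆ ψ '' Metric.closedBall 0 r := by
      refine Set.Subset.trans (fun g hg => ?_) (hincl r hr0.le hrr₁)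
      obtain ⟨hκ1, hκ2⟩ := hκ r hr0.le hrr₁
      simp only [Set.mem_setOf_eq] at hg ⊢
      refine hg.trans ?_
      rw [le_div_iff₀ (by linarith)]
      nlinarith
    have hsub : (Set.pi Set.univ fun _ : FreeIdx d n => {g : G | ‖ρ g - 1‖ ≤ rho0 C d n β}) ⊆
        Set.pi Set.univ fun _ => ψ '' Metric.closedBall 0 r :=
      Set.pi_mono fun _ _ => hball
    refine (lintegral_mono_set hsub).trans ?_
    -- the chart comparison (Thm. 11.1)
    refine (hup n r hr0 hrr₁ f hfm).trans (mul_le_mul_right ?_ _)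
    -- Thm. 16.3 on the ball, then drop the ball
    calc ∫⁻ a in Set.pi Set.univ (fun _ => Metric.closedBall (0 : EuclideanSpace ℝ (Fin D)) r),
          f (fun i => ψ (a i))
        ≤ ∫⁻ a in Set.pi Set.univ (fun _ => Metric.closedBall (0 : EuclideanSpace ℝ (Fin D)) r),
            ENNReal.ofReal (Real.exp (A₀ * N * β * r ^ 3 * (ChatterjeeAssembly.Pn d n : ℝ))) *
              ENNReal.ofReal (Real.exp (-β * maxwellV d n a / 2)) :=
          setLIntegral_mono ((measurable_maxwellWeight β).const_mul _) fun a ha =>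
            weight_le_of_abs_le hβ0
              (abs_action_sub_maxwellV_le ι₀ hψ hι₀ h4 hr0.le hr1 (norm_le_of_mem_pi ha))
      _ = ENNReal.ofReal (Real.exp (A₀ * N * β * r ^ 3 * (ChatterjeeAssembly.Pn d n : ℝ))) *
            ∫⁻ a in Set.pi Set.univ (fun _ => Metric.closedBall (0 : EuclideanSpace ℝ (Fin D)) r),
              ENNReal.ofReal (Real.exp (-β * maxwellV d n a / 2)) :=
          lintegral_const_mul _ (measurable_maxwellWeight β)
      _ ≤ _ := mul_le_mul_right (setLIntegral_le_lintegral _ _) _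
  · -- Lemma 17.6 up to the Gaussian estimates
    have hr1 : r ≤ 1 := hrr₁.trans hr₁
    set f := fun v : FreeIdx d n → G =>
      ENNReal.ofReal (Real.exp (-β * zdWilsonAction ρ (halfOpenBox d n) (ext (ext₁ v))))
    have hfm : Measurable f := measurable_weight_free ρ hρ β
    rw [zdPartitionFunction_eq_lintegral_free ρ hρ β]
    refine le_trans ?_ (setLIntegral_le_lintegral
      (Set.pi Set.univ fun _ : FreeIdx d n => ψ '' Metric.closedBall 0 r) _)
    refine le_trans ?_ (hlow n r hr hrr₁ f hfm)
    refine mul_le_mul_right ?_ _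
    calc ENNReal.ofReal (Real.exp (-(A₀ * N * β * r ^ 3 * (ChatterjeeAssembly.Pn d n : ℝ)))) *
          ∫⁻ a in Set.pi Set.univ (fun _ : FreeIdx d n => Metric.closedBall (0 : EuclideanSpace ℝ (Fin D)) r),
            ENNReal.ofReal (Real.exp (-β * maxwellV d n a / 2))
        = ∫⁻ a in Set.pi Set.univ (fun _ : FreeIdx d n => Metric.closedBall (0 : EuclideanSpace ℝ (Fin D)) r),
            ENNReal.ofReal (Real.exp (-(A₀ * N * β * r ^ 3 * (ChatterjeeAssembly.Pn d n : ℝ)))) *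
              ENNReal.ofReal (Real.exp (-β * maxwellV d n a / 2)) :=
          (lintegral_const_mul _ (measurable_maxwellWeight β)).symm
      _ ≤ ∫⁻ a in Set.pi Set.univ (fun _ : FreeIdx d n => Metric.closedBall (0 : EuclideanSpace ℝ (Fin D)) r),
            f (fun i => ψ (a i)) :=
          setLIntegral_mono (hfm.comp (hψPi n)) fun a ha => le_weight_of_abs_le hβ
            (abs_action_sub_maxwellV_le ι₀ hψ hι₀ h4 hr.le hr1 (norm_le_of_mem_pi ha))

end Stub

end Summit.QuantumFields.YangMills.Theorems.FreeEnergyLogCoefficient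

end
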